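import Summits.PneNP.PneNP.Theorems.PermanentDescentCollapseMakesPermanentEasyIslandDefs
import Summits.PneNP.PneNP.Theorems.PermanentDescentPermanentNotInPStubPermBitsPPP
import Literature.Computability.Complexity.CodeFPFinite
import Literature.Computability.Complexity.CodeFPListKit
import Literature.Computability.Complexity.CodeFPTableKit
import Literature.Computability.Complexity.CodeFPStrings
import HarnessLib

/-!
# Route PermanentDescent, crux `CollapseMakesPermanentEasy` (stmt-PneNP-16142), line `Sketch`
# (idea `errorless-islands`) — `stub_valFP`: the advice-taking decider is polynomial time

Registered stub `stub_valFP` of the skeleton `Cruxes/CollapseMakesPermanentEasy/Lines/Sketch.lean`, over the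
objects of `Theorems/PermanentDescentCollapseMakesPermanentEasyIslandDefs.lean` (namespace
`Summit.PneNP.PneNP.Theorems.PermIsland`): on the code of `(x, A)` (query string, advice = raw list of side
records, code `rawE srE`) the decider `decideX χ A x` is computed in polynomial time, GIVEN that the line
decoder `((p, n), ((vs, ls), (m, d))) ↦ lineTry χ p n vs ls m d` is (the statement of the neighbouring stub
`stub_lineFP`, entering as a hypothesis). The proof is pure `CodeFP` plumbing (no machine is written):

* `resOfWord_codeFP`: the residue list of a 0/1 word — a `map` over the index range `[0, |s|)` reading each
  letter with `strGetDNat`;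
* `resFor_codeFP`: the decoded residue of one prime record — `findSomeFP` of the line decoder over the advice
  directions, defaulted to `0` by `optGetD`;
* `crtVal_codeFP`: Chinese remaindering — a `map` over the prime records (`modMul` of the decoded residue and
  the idempotent) followed by the running sum `modSum`;
* `valR_codeFP`: the table lookup `tabVal` (`rawFind?` on the word, `optMap` of `Prod.snd`) defaulted by
  `optGetD` to the remaindered value;
* `stub_valFP`: the parse of `x = ⟨s, bin i⟩` (`fstF`, `sndF`, `strVal`, the test `PermCert.wfB` by
  `XpLadder.wfB_codeFP`), the record of side `√|s|` by `rawGetOr`, its value by `valR_codeFP`, the bit by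
  `testBitNat`.
-/

set_option linter.dupNamespace false -- `Summit.PneNP.PneNP.…`: summit = sub-problem name (D-0017 single-conjunct layout)

namespace Summit.PneNP.PneNP.Theorems.PermIsland

open _root_.Computability
open Literature.Computability.Complexity Literature.Computability.Complexity.CodeFP
  Literature.Computability.Complexity.Brick Literature.Computability.Complexity.ModArith
  Summit.PneNP.PneNP.Theorems.PermCert

/-! ### §1 The residue list of a word -/

/-- **The residue list of a 0/1 word is polynomial time on codes**: a `map` over the index range
`[0, |s|)` (`urange ∘ strLength`) reading each letter by `strGetDNat` and writing `1`/`0`.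
[cite: AroraBarakCC2009, §1.3] -/
theorem resOfWord_codeFP : CodeFP strE (rawE natE) resOfWord := by
  -- the letter of position `i` (context `q.1 = s`, item `q.2 = i`)
  have hitem : CodeFP (pairE strE natE) natE (fun q => if q.1.getD q.2 false then (1 : ℕ) else 0) :=
    strGetDNat.ite (const _ 1) (const _ 0)
  have hr : CodeFP strE (rawE natE) (fun s => List.range s.length) := urange.comp strLength
  refine ((CodeFP.map hitem).comp ((CodeFP.id strE).pair hr)).congr fun s => ?_
  show ((List.range s.length).map fun i => if s.getD i false then (1 : ℕ) else 0) =
    s.map fun b => if b then 1 else 0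
  apply List.ext_getElem
  · rw [List.length_map, List.length_map, List.length_range]
  · intro i h₁ h₂
    rw [List.length_map, List.length_range] at h₁
    rw [List.getElem_map, List.getElem_map, List.getElem_range, List.getD_eq_getElem _ _ h₁]

/-! ### §2 One prime record: the decoded residue -/

/-- **The decoded residue of one prime record is polynomial time on codes**: on the code of
`((n, m), P)` (`P = (p, vs, ls, e, dirs)`, code `prE`), `resFor χ n P m` is `findSomeFP` of the line
decoder (the hypothesis, re-paired to `((p, n), ((vs, ls), (m, d)))`) over the advice directions `dirs`,
defaulted to `0` by `optGetD`. [cite: AroraBarakCC2009, §1.3] -/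
theorem resFor_codeFP (χ : List Bool → Bool)
    (hline : CodeFP (pairE (pairE natE natE) (pairE (pairE (rawE natE) (rawE natE)) (pairE (rawE natE) (rawE natE))))
      (optE natE) (fun t => lineTry χ t.1.1 t.1.2 t.2.1.1 t.2.1.2 t.2.2.1 t.2.2.2)) :
    CodeFP (pairE (pairE natE (rawE natE)) prE) natE (fun w => resFor χ w.1.1 w.2 w.1.2) := by
  -- one attempt: context `q.1 = ((n, m), P)`, item `q.2 = d` (a direction)
  let W : ((ℕ × List ℕ) × PRec) × List ℕ → List Bool := pairE (pairE (pairE natE (rawE natE)) prE) (rawE natE)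
  have wn : CodeFP W natE (fun q => q.1.1.1) := (fst _ _).fst'.fst'
  have wm : CodeFP W (rawE natE) (fun q => q.1.1.2) := (fst _ _).fst'.snd'
  have wP : CodeFP W prE (fun q => q.1.2) := (fst _ _).snd'
  have wp : CodeFP W natE (fun q => q.1.2.1) := wP.fst'
  have wvs : CodeFP W (rawE natE) (fun q => q.1.2.2.1) := wP.snd'.fst'
  have wls : CodeFP W (rawE natE) (fun q => q.1.2.2.2.1) := wP.snd'.snd'.fst'
  have wd : CodeFP W (rawE natE) (fun q => q.2) := snd _ _
  have hf : CodeFP W (optE natE) (fun q => lineTry χ q.1.2.1 q.1.1.1 q.1.2.2.1 q.1.2.2.2.1 q.1.1.2 q.2) :=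
    (hline.comp ((wp.pair wn).pair ((wvs.pair wls).pair (wm.pair wd))) :)
  -- the scan of the directions and the default
  have hdirs : CodeFP (pairE (pairE natE (rawE natE)) prE) (rawE (rawE natE)) (fun w => w.2.2.2.2.2) :=
    (snd _ _).snd'.snd'.snd'.snd'
  have hfind : CodeFP (pairE (pairE natE (rawE natE)) prE) (optE natE)
      (fun w => w.2.2.2.2.2.findSome? fun d => lineTry χ w.2.1 w.1.1 w.2.2.1 w.2.2.2.1 w.1.2 d) :=
    ((findSomeFP hf).comp ((CodeFP.id _).pair hdirs)).congr fun _ => rfl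
  exact ((optGetD natE).comp (hfind.pair (const _ 0))).congr fun _ => rfl

/-! ### §3 One side record: Chinese remaindering, the table, the value -/

/-- **Chinese remaindering is polynomial time on codes**: on the code of `((n, m), r)`
(`r = (N, tab, prs)`, code `srE`), `crtVal χ n r m` is a `map` over the prime records `prs` (the summand
`mulM N (resFor χ n P m) e_P` by `modMul`, context `(N, (n, m))`) followed by the running sum modulo `N`
(`modSum`). [cite: AroraBarakCC2009, §1.3] -/
theorem crtVal_codeFP (χ : List Bool → Bool)
    (hline : CodeFP (pairE (pairE natE natE) (pairE (pairE (rawE natE) (rawE natE)) (pairE (rawE natE) (rawE natE))))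
      (optE natE) (fun t => lineTry χ t.1.1 t.1.2 t.2.1.1 t.2.1.2 t.2.2.1 t.2.2.2)) :
    CodeFP (pairE (pairE natE (rawE natE)) srE) natE (fun w => crtVal χ w.1.1 w.2 w.1.2) := by
  -- the summand of a prime record: context `u.1 = (N, (n, m))`, item `u.2 = P`
  let C : (ℕ × ℕ × List ℕ) × PRec → List Bool := pairE (pairE natE (pairE natE (rawE natE))) prE
  have cN : CodeFP C natE (fun u => u.1.1) := (fst _ _).fst'
  have ce : CodeFP C natE (fun u => u.2.2.2.2.1) := (snd _ _).snd'.snd'.snd'.fst'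
  have cres : CodeFP C natE (fun u => resFor χ u.1.2.1 u.2 u.1.2.2) :=
    ((resFor_codeFP χ hline).comp ((fst _ _).snd'.pair (snd _ _))).congr fun _ => rfl
  have cg : CodeFP C natE (fun u => mulM u.1.1 (resFor χ u.1.2.1 u.2 u.1.2.2) u.2.2.2.2.1) :=
    modMul cN cres ce
  -- the record: `w = ((n, m), (N, tab, prs))`
  let R : (ℕ × List ℕ) × SRec → List Bool := pairE (pairE natE (rawE natE)) srE
  have rN : CodeFP R natE (fun w => w.2.1) := (snd _ _).fst'
  have rprs : CodeFP R (rawE prE) (fun w => w.2.2.2) := (snd _ _).snd'.snd'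
  have hmap : CodeFP R (rawE natE)
      (fun w => w.2.2.2.map fun P => mulM w.2.1 (resFor χ w.1.1 P w.1.2) P.2.2.2.1) :=
    ((CodeFP.map cg).comp ((rN.pair (fst _ _)).pair rprs)).congr fun _ => rfl
  exact (modSum rN hmap).congr fun _ => rfl

/-- **The record's value is polynomial time on codes**: on the code of `(n, (r, s))`, `valR χ n r s` is
the table lookup (`rawFind?` of the word `s` in `tab`, `optMap` of `Prod.snd`) defaulted by `optGetD` to
the remaindered value at the residue list of `s`. [cite: AroraBarakCC2009, §1.3] -/
theorem valR_codeFP (χ : List Bool → Bool)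
    (hline : CodeFP (pairE (pairE natE natE) (pairE (pairE (rawE natE) (rawE natE)) (pairE (rawE natE) (rawE natE))))
      (optE natE) (fun t => lineTry χ t.1.1 t.1.2 t.2.1.1 t.2.1.2 t.2.2.1 t.2.2.2)) :
    CodeFP (pairE natE (pairE srE strE)) natE (fun v => valR χ v.1 v.2.1 v.2.2) := by
  let V : ℕ × SRec × List Bool → List Bool := pairE natE (pairE srE strE)
  have vn : CodeFP V natE (fun v => v.1) := fst _ _
  have vr : CodeFP V srE (fun v => v.2.1) := (snd _ _).fst'
  have vs : CodeFP V strE (fun v => v.2.2) := (snd _ _).snd'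
  have vtab : CodeFP V (rawE (pairE strE natE)) (fun v => v.2.1.2.1) := vr.snd'.fst'
  -- the table lookup: context `t.1 = s`, item `t.2 = (word, value)`
  have hp : CodeFP (pairE strE (pairE strE natE)) bitE (fun t => decide (t.2.1 = t.1)) :=
    ((CodeFP.eq (eα := strE) fun _ _ h => h).comp ((snd _ _).fst'.pair (fst _ _)) :)
  have hfind : CodeFP V (optE (pairE strE natE)) (fun v => v.2.1.2.1.find? fun q => decide (q.1 = v.2.2)) :=
    ((rawFind? hp).comp (vs.pair vtab)).congr fun _ => rfl
  have htab : CodeFP V (optE natE) (fun v => tabVal v.2.1.2.1 v.2.2) :=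
    ((optMap (eσ := V) (eα := pairE strE natE) (g := fun t => t.2.2) (snd _ _).snd').comp
      ((CodeFP.id V).pair hfind)).congr fun _ => rfl
  -- the default: the remaindered decoded residues at the residue list of `s`
  have hcrt : CodeFP V natE (fun v => crtVal χ v.1 v.2.1 (resOfWord v.2.2)) :=
    ((crtVal_codeFP χ hline).comp ((vn.pair (resOfWord_codeFP.comp vs)).pair vr)).congr fun _ => rfl
  exact ((optGetD natE).comp (htab.pair hcrt)).congr fun _ => rfl

/-! ### §4 The stub: the advice-taking decider -/

/-- **Stub VF (the advice-taking decider is polynomial time; machine level).** On the code of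
`(x, A)` (query string, advice = raw list of side records), `decideX χ A x` is computed in polynomial time,
given the line decoder of Stub LF: parse `x = ⟨s, bin i⟩` (`fstF`, `sndF`, `strVal`; the well-formedness
test `PermCert.wfB` by `XpLadder.wfB_codeFP`), read the record of side `√|s|` off `A` (`natSqrt`,
`rawGetOr`, default `defaultRec`), evaluate it at `s` (`valR_codeFP`) and test bit `i` (`testBitNat`).
[cite: AroraBarakCC2009, §1.3, Thm. 6.18] -/
theorem stub_valFP :
    ∀ χ : List Bool → Bool, CodeFP strE bitE χ →
      CodeFP (pairE (pairE natE natE) (pairE (pairE (rawE natE) (rawE natE)) (pairE (rawE natE) (rawE natE))))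
        (optE natE) (fun t => lineTry χ t.1.1 t.1.2 t.2.1.1 t.2.1.2 t.2.2.1 t.2.2.2) →
      CodeFP (pairE strE (rawE srE)) bitE (fun t => decideX χ t.2 t.1) := by
  intro χ _ hline
  -- the parse of the query
  have hs : CodeFP strE strE fstF := of_fn fstF fstF_mem_FP fun _ => rfl
  have ht : CodeFP strE strE sndF := of_fn sndF sndF_mem_FP fun _ => rfl
  have hi : CodeFP strE natE (fun x => bitsToNat (sndF x)) := strVal.comp ht
  have hlen : CodeFP strE natE (fun x => (fstF x).length) := (natOfUn.comp (strLength.comp hs) :)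
  -- the input `t = (x, A)`
  let T : List Bool × List SRec → List Bool := pairE strE (rawE srE)
  have tx : CodeFP T strE (fun t => t.1) := fst _ _
  have tn : CodeFP T natE (fun t => Nat.sqrt (fstF t.1).length) := natSqrt.comp (hlen.comp tx)
  have trec : CodeFP T srE (fun t => t.2.getD (Nat.sqrt (fstF t.1).length) defaultRec) :=
    ((rawGetOr srE).comp ((snd _ _).pair (tn.pair (const _ defaultRec))) :)
  have tval : CodeFP T natE (fun t => valR χ (Nat.sqrt (fstF t.1).length)
      (t.2.getD (Nat.sqrt (fstF t.1).length) defaultRec) (fstF t.1)) :=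
    ((valR_codeFP χ hline).comp (tn.pair (trec.pair (hs.comp tx)))).congr fun _ => rfl
  have tbit : CodeFP T bitE (fun t => (valR χ (Nat.sqrt (fstF t.1).length)
      (t.2.getD (Nat.sqrt (fstF t.1).length) defaultRec) (fstF t.1)).testBit (bitsToNat (sndF t.1))) :=
    testBitNat.comp (tval.pair (hi.comp tx))
  exact ((XpLadder.wfB_codeFP.comp tx).and tbit).congr fun _ => rfl

end Summit.PneNP.PneNP.Theorems.PermIsland
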